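import Summits.HodgeConjecture.HodgeConjecture.Theorems.K2E3WildAnisotropicResidualCountOfParts   -- ★ p857155 (K2E5-p07 (g3)): the (C2) closer `anCount_of_struct_of_topIndex_of_ladder (hS) (hTop) (hLad)`
import Summits.HodgeConjecture.HodgeConjecture.Theorems.K2E3WildPlaneAnisoCountStructure          -- ★ p857158 (K2E5-p16 (g3)): (C2-struct) `relIndex_levelOf_anisoPlane_eq_mul` — discharges `hS`
import HarnessLib

/-!
# (C2) «wild anisotropic residual count» from (C2b-i) and (C2b-ii) ONLY — the (C2-struct) hypothesis discharged by name

Road (d-w) of ‹J3› v2 (road owner K2E3-p03 (g3), dealer K2E3-plan (g3); cell hodgecm-mathlib, Track B «K2-LIT», item h413 =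
stmt-HodgeConjecture-24833, supports-only).  ★ p857155 `K2E3WildAnisotropicResidualCountOfParts.anCount_of_struct_of_topIndex_of_ladder` proves
K2E3-p03 (g3)'s letter (C2) `sig_K2E3WildAnisotropicResidualCount` from three closed letters `hS` (C2-struct), `hTop` (C2b-i), `hLad` (C2b-ii).
★ p857158 `K2E3WildPlaneAnisoCountStructure.relIndex_levelOf_anisoPlane_eq_mul` IS the letter `hS` binder for binder, so this module
records the partial application: **(C2) now rests on exactly {(C2b-i), (C2b-ii)}** (K2E4-p07 (g4), K2E4-p14 (g4)).  No new mathematics;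
count-neutral (h413 stays OPEN; HC_CM is proved only modulo the printed citations until rung 0 closes).

[cite: PlatonovRapinchuk1994, §3.3, §5.1] [cite: Rogawski1990, §3.8 p. 33]
-/

set_option autoImplicit false
set_option linter.dupNamespace false

open NumberField IsDedekindDomain MeasureTheory
open Literature.NumberTheory.Automorphic Literature.NumberTheory.Automorphic.UnitaryGroup Literature.NumberTheory.Rogawski1990
open Literature.NumberTheory.Weil1982.UnitaryFinTopForm
open scoped MatrixGroups Matrix NNReal

namespace Summit.HodgeConjecture.HodgeConjecture.Cruxes.H413.K2E3WildAnisotropicResidualCountOfTopIndexLadder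

open Summit.HodgeConjecture.HodgeConjecture.Cruxes.H413

open Set Matrix Literature.NumberTheory.Automorphic.UnitaryGroup Literature.NumberTheory.GaloisRepresentations in
open scoped NNReal Classical in
/-- **(C2) from (C2b-i) «top index» and (C2b-ii) «ladder» alone.**  The (C2) closer ★ `anCount_of_struct_of_topIndex_of_ladder` with its
(C2-struct) hypothesis `hS` discharged by ★ `K2E3WildPlaneAnisoCountStructure.relIndex_levelOf_anisoPlane_eq_mul`
(`N_an = [S_an : S_an ∩ K(4)] · [T : T_n]`); `hTop`, `hLad` and the conclusion are the closer's bytes VERBATIM.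
[cite: PlatonovRapinchuk1994, §3.3, §5.1] -/
theorem anCount_of_topIndex_of_ladder
    (hTop :
      ∀ (L : Type) [Field L] [NumberField L] [IsCMField L] (v : HeightOneSpectrum (𝓞 ↥(maximalRealSubfield L)))
        (w : UnitaryGroup.PlacesOver L v) (hw : IsCMField.complexConj L • w.1 = w.1),
        v.asIdeal.ramificationIdx' w.1.asIdeal ≠ 1 → (2 : 𝓞 ↥(maximalRealSubfield L)) ∈ v.asIdeal →
        ∀ (d : ℕ), (∀ τ : w.1.adicCompletion L, Valued.v τ = WithZero.exp (-1 : ℤ) →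
          Valued.v (galAdicCompletionMap (L := L) (IsCMField.complexConj L) hw τ - τ) = WithZero.exp (-(d : ℤ))) →
        ∀ (ξ : L), IsCMField.complexConj L ξ = ξ → Valued.v (algebraMap L (w.1.adicCompletion L) ξ) = 1 →
        (¬ ∃ t : w.1.adicCompletion L, t * galAdicCompletionMap (L := L) (IsCMField.complexConj L) hw t = algebraMap L (w.1.adicCompletion L) ξ) →
        ∀ (S : Subgroup ((UnitaryGroup.cmDatum L 2 !![(1 : L), 0; 0, -ξ]).Local v)),
        (∀ g : (UnitaryGroup.cmDatum L 2 !![(1 : L), 0; 0, -ξ]).Local v, g ∈ S ↔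
          (((localNonsplitEquiv (IsCMField.complexConj L) !![(1 : L), 0; 0, -ξ] (IsCMField.complexConj_ne_one L) w hw g :
              ↥(unitaryGroupOfForm (galAdicCompletionMap (L := L) (IsCMField.complexConj L) hw) (placeForm !![(1 : L), 0; 0, -ξ] w.1))) :
            GL (Fin 2) (w.1.adicCompletion L)) : Matrix (Fin 2) (Fin 2) (w.1.adicCompletion L)).det = 1) →
        (S ⊓ cmLocalIntegralLevel L 2 !![(1 : L), 0; 0, -ξ] v).relIndex S =
          (Nat.card (𝓞 ↥(maximalRealSubfield L) ⧸ v.asIdeal) + 1) * Nat.card (𝓞 ↥(maximalRealSubfield L) ⧸ v.asIdeal) ^ (d - 2))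
    (hLad :
      ∀ (L : Type) [Field L] [NumberField L] [IsCMField L] (v : HeightOneSpectrum (𝓞 ↥(maximalRealSubfield L)))
        (w : UnitaryGroup.PlacesOver L v) (hw : IsCMField.complexConj L • w.1 = w.1),
        v.asIdeal.ramificationIdx' w.1.asIdeal ≠ 1 → (2 : 𝓞 ↥(maximalRealSubfield L)) ∈ v.asIdeal →
        ∀ (m d : ℕ), Valued.v (2 : v.adicCompletion ↥(maximalRealSubfield L)) = WithZero.exp (-(m : ℤ)) →
        (∀ τ : w.1.adicCompletion L, Valued.v τ = WithZero.exp (-1 : ℤ) →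
          Valued.v (galAdicCompletionMap (L := L) (IsCMField.complexConj L) hw τ - τ) = WithZero.exp (-(d : ℤ))) →
        ∀ (ξ : L), IsCMField.complexConj L ξ = ξ → Valued.v (algebraMap L (w.1.adicCompletion L) ξ) = 1 →
        (¬ ∃ t : w.1.adicCompletion L, t * galAdicCompletionMap (L := L) (IsCMField.complexConj L) hw t = algebraMap L (w.1.adicCompletion L) ξ) →
        ∀ (ha : ∀ w' : UnitaryGroup.PlacesOver L v, Valued.v (((resChar L v : ℕ) : UnitaryGroup.LocalRing L v) w') < 1)
          (S : Subgroup ((UnitaryGroup.cmDatum L 2 !![(1 : L), 0; 0, -ξ]).Local v)),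
        (∀ g : (UnitaryGroup.cmDatum L 2 !![(1 : L), 0; 0, -ξ]).Local v, g ∈ S ↔
          (((localNonsplitEquiv (IsCMField.complexConj L) !![(1 : L), 0; 0, -ξ] (IsCMField.complexConj_ne_one L) w hw g :
              ↥(unitaryGroupOfForm (galAdicCompletionMap (L := L) (IsCMField.complexConj L) hw) (placeForm !![(1 : L), 0; 0, -ξ] w.1))) :
            GL (Fin 2) (w.1.adicCompletion L)) : Matrix (Fin 2) (Fin 2) (w.1.adicCompletion L)).det = 1) →
        (levelOf L 2 !![(1 : L), 0; 0, -ξ] v 1 (ballMat L 2 v ((resChar L v : ℕ) : UnitaryGroup.LocalRing L v))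
                (ballMat_mul_closed L 2 v (mem_localIntegers_of_forall_valued_lt_one L v ha)) ⊓ S).relIndex
              (S ⊓ cmLocalIntegralLevel L 2 !![(1 : L), 0; 0, -ξ] v) =
          Nat.card (𝓞 ↥(maximalRealSubfield L) ⧸ v.asIdeal) ^ (6 * m - d / 2)) :

    ∀ (L : Type) [Field L] [NumberField L] [IsCMField L] (v : HeightOneSpectrum (𝓞 ↥(maximalRealSubfield L)))
      (w : UnitaryGroup.PlacesOver L v) (hw : IsCMField.complexConj L • w.1 = w.1),
      (2 : 𝓞 ↥(maximalRealSubfield L)) ∈ v.asIdeal → ¬ Algebra.IsUnramifiedIn (𝓞 L) v.asIdeal →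
      ∀ (m : ℕ), Valued.v (2 : v.adicCompletion ↥(maximalRealSubfield L)) = WithZero.exp (-(m : ℤ)) →
      ∀ (ξ : L), IsCMField.complexConj L ξ = ξ → Valued.v (algebraMap L (w.1.adicCompletion L) ξ) = 1 →
      (¬ ∃ t : w.1.adicCompletion L, t * galAdicCompletionMap (L := L) (IsCMField.complexConj L) hw t = algebraMap L (w.1.adicCompletion L) ξ) →
      ∀ (ha : ∀ w' : UnitaryGroup.PlacesOver L v, Valued.v (((resChar L v : ℕ) : UnitaryGroup.LocalRing L v) w') < 1)
        (α : (w.1.adicCompletion L)ˣ), galAdicCompletionMap (L := L) (IsCMField.complexConj L) hw (α : w.1.adicCompletion L) = -(α : w.1.adicCompletion L) →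
      (Valued.v (α : w.1.adicCompletion L) = WithZero.exp (-1 : ℤ) →
        (levelOf L 2 !![(1 : L), 0; 0, -ξ] v 1 (ballMat L 2 v ((resChar L v : ℕ) : UnitaryGroup.LocalRing L v))
                (ballMat_mul_closed L 2 v (mem_localIntegers_of_forall_valued_lt_one L v ha))).relIndex
              (Subgroup.centralizer ({(1 : (UnitaryGroup.cmDatum L 2 !![(1 : L), 0; 0, -ξ]).Local v)} : Set _)) =
          2 * (Nat.card (𝓞 ↥(maximalRealSubfield L) ⧸ v.asIdeal) + 1) * Nat.card (𝓞 ↥(maximalRealSubfield L) ⧸ v.asIdeal) ^ (8 * m - 1)) ∧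
      (Valued.v (α : w.1.adicCompletion L) = 1 →
        (levelOf L 2 !![(1 : L), 0; 0, -ξ] v 1 (ballMat L 2 v ((resChar L v : ℕ) : UnitaryGroup.LocalRing L v))
                (ballMat_mul_closed L 2 v (mem_localIntegers_of_forall_valued_lt_one L v ha))).relIndex
              (Subgroup.centralizer ({(1 : (UnitaryGroup.cmDatum L 2 !![(1 : L), 0; 0, -ξ]).Local v)} : Set _)) =
          2 * (Nat.card (𝓞 ↥(maximalRealSubfield L) ⧸ v.asIdeal) + 1) * Nat.card (𝓞 ↥(maximalRealSubfield L) ⧸ v.asIdeal) ^ (8 * m - 2)) :=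
  K2E3WildAnisotropicResidualCountOfParts.anCount_of_struct_of_topIndex_of_ladder
    (fun L _ _ _ v w hw _ hξ1 ha S hS T Tn hT hTn =>
      K2E3WildPlaneAnisoCountStructure.relIndex_levelOf_anisoPlane_eq_mul L v w hw hξ1 ha S hS T Tn hT hTn) hTop hLad

end Summit.HodgeConjecture.HodgeConjecture.Cruxes.H413.K2E3WildAnisotropicResidualCountOfTopIndexLadder
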